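import Literature.Combinatorics.LorentzianPolynomials.MathlibMatroid
import Mathlib.Combinatorics.Matroid.Minor.Restrict
import HarnessLib

/-!
# The independent sets of a matroid form an M♮-convex set: their homogenisation is M-convex
# (Brändén–Huh 2020, §2.4 Lemma 2.21, matroid case; the support of `f_M = Σ_{I} w^I w_0^{n-|I|}` of §4.3)

Layer `Literature/Combinatorics/LorentzianPolynomials`, namespace `Literature.Combinatorics.LorentzianPolynomials`;
lane `lit-hodgefound` (Track 2 foundations library), seat p16, generation 27 (row g27-#20). Builds on `MathlibMatroid.lean`
(`indSet B = e_B`) and Mathlib's matroid library (`Matroid.Indep`, `Matroid.Indep.subset`, `Matroid.Indep.augment`).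

## Source (verbatim) — P. Brändén, J. Huh, *Lorentzian polynomials* [BrandenHuh2019] (held `paper:arxiv-1902.03719`)

§2.4: "A subset `J♮ ⊆ ℕ^n` is said to be M♮-convex if there is an M-convex set `J` in `ℕ^{n+1}` such that
`J♮ = {(α_1, …, α_n) | (α_1, …, α_n, α_{n+1}) ∈ J}`. […] The augmentation property for `J♮ ⊆ ℕ^n` is the implication
(`α ∈ J♮`, `β ∈ J♮`, `|α|_1 < |β|_1`) ⟹ (`α_j < β_j` and `α + e_j ∈ J♮` for some `j ∈ [n]`). **Lemma 2.21.** Let `J♮` be an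
interval convex subset of `ℕ^n` containing `0`. Then `J♮` is M♮-convex if and only if `J♮` satisfies the augmentation
property. Therefore, a nonempty interval convex subset of `{0,1}^n` containing `0` is M♮-convex if and only if it is the
collection of independent sets of a matroid on `[n]`. *Proof.* Let `d` be any sufficiently large positive integer, and set
`J = {(α_1, …, α_n, d - α_1 - ⋯ - α_n) ∈ ℕ^{n+1} | (α_1, …, α_n) ∈ J♮}`. […] We prove the "if" direction by checking the
exchange property for `J`. Let `α` and `β` be elements of `J`, and let `i` be an index satisfying `α_i > β_i`. We claim
that there is an index `j` satisfying `α_j < β_j` and `α - e_i + e_j ∈ J`. By the augmentation property for `J♮`, it is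
enough to justify the claim when `i ≠ n+1`. When `α_{n+1} < β_{n+1}`, then we may take `j = n+1` […]. Suppose
`α_{n+1} ≥ β_{n+1}`. In this case, we consider the element `γ = α - e_i + e_{n+1}`. The element `γ` belongs to `J`,
because `J♮` is an interval convex set containing `0`. We have `γ_{n+1} > β_{n+1}`, and hence the augmentation property
for `J♮` gives an index `j` satisfying `γ_j < β_j` and `α - e_i + e_j = γ - e_{n+1} + e_j ∈ J`." §4.3 (proof of
Thm. 4.14): "`f_M(w_0, w_1, …, w_n) = Σ_{A ∈ 𝓘(M)} w^A w_0^{n-|A|}`, where `𝓘(M)` is the collection of independent sets of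
`M`."

## What is here (`σ` a finite type with `n = |σ|` elements, `M : Matroid σ`; the extra variable `w_0` is `none : Option σ`)

* `homIndSet I = (n - |I|) e_0 + e_I ∈ ℕ^{Option σ}` (the exponent of `w^I w_0^{n-|I|}`; `homIndSet_none/_some`,
  `degree_homIndSet = n`, `homIndSet_injective`, the three moves `homIndSet_insert`, `homIndSet_diff`,
  `homIndSet_insert_diff`);
* `indepExp M = {homIndSet I : I independent in M}` (the support of `f_M`; `mem_indepExp`);
* **`isMConvex_indepExp`**: it is M-convex — the printed exchange argument with Mathlib's augmentation
  `Matroid.Indep.augment` (case `i = 0`: augment `I` from `J`; case `i ∈ I`, `|I| > |J|`: move to `w_0` by `I ∖ i`;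
  case `i ∈ I`, `|I| ≤ |J|`: augment `I ∖ i` from `J`), i.e. the independent sets of a matroid form an M♮-convex set.

Two definitions with bodies (`homIndSet`, `indepExp`), theorems otherwise; no `sorry`, no named fact. The converse of
Lemma 2.21 (M♮-convex hereditary `0/1` families are matroids) and the Lorentzian property of `f_M` (Thm. 4.10 at `q → 0`)
are not treated here. -- TODO(general form): Lemma 2.21 in full; `f_M ∈ L^n_{n+1}`.

## References

* [BrandenHuh2019] P. Brändén, J. Huh, *Lorentzian polynomials*, Ann. of Math. (2) 192 (2020) 821–891, arXiv:1902.03719 —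
  §2.4 Lemma 2.21; §4.3 (proof of Thm. 4.14).
-/

noncomputable section

open Finsupp Finset

namespace Literature.Combinatorics.LorentzianPolynomials

variable {σ : Type*} [Fintype σ]

/-! ## §1 The exponent `(n - |I|) e_0 + e_I` of `w^I w_0^{n-|I|}` -/

section HomIndSet

/-- **The homogenised indicator `(n - |I|) e_0 + e_I ∈ ℕ^{Option σ}`** of a subset `I ⊆ σ`, `n = |σ|`: the exponent of the
monomial `w^I w_0^{n-|I|}` of `f_M`, the homogenising variable `w_0` being the index `none`.
[cite: BrandenHuh2019, §4.3 proof of Thm. 4.14 ("`w^A w_0^{n-|A|}`"); §2.4 proof of Lemma 2.21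
("`(α_1, …, α_n, d - α_1 - ⋯ - α_n)`")] -/
def homIndSet (I : Set σ) : Option σ →₀ ℕ :=
  Finsupp.equivFunOnFinite.symm fun o ↦ o.elim (Fintype.card σ - I.ncard) fun i ↦ indSet I i

/-- The `w_0`-exponent: `n - |I|`. [cite: BrandenHuh2019, §4.3 proof of Thm. 4.14] -/
theorem homIndSet_none (I : Set σ) : homIndSet I none = Fintype.card σ - I.ncard := by
  rw [homIndSet, Finsupp.coe_equivFunOnFinite_symm, Option.elim_none]

/-- The `w_i`-exponent: `[i ∈ I]`. [cite: BrandenHuh2019, §4.3 proof of Thm. 4.14] -/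
theorem homIndSet_some (I : Set σ) (i : σ) : homIndSet I (some i) = indSet I i := by
  rw [homIndSet, Finsupp.coe_equivFunOnFinite_symm, Option.elim_some]

/-- `|I| ≤ n`. [cite: BrandenHuh2019, §2.4 proof of Lemma 2.21 ("`d` […] sufficiently large")] -/
theorem ncard_le_card (I : Set σ) : I.ncard ≤ Fintype.card σ := by
  rw [← Nat.card_eq_fintype_card]
  exact Set.ncard_le_card I

/-- The total degree is `n`: `(n - |I|) + |I| = n`. [cite: BrandenHuh2019, §4.3 proof of Thm. 4.14 (`f_M` is homogeneous
of degree `n`)] -/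
theorem degree_homIndSet (I : Set σ) : (homIndSet I).degree = Fintype.card σ := by
  rw [Finsupp.degree_eq_sum, Fintype.sum_option, homIndSet_none]
  simp_rw [homIndSet_some]
  rw [← Finsupp.degree_eq_sum, degree_indSet]
  have h := ncard_le_card I
  omega

/-- `I ↦ (n - |I|) e_0 + e_I` is injective. [cite: BrandenHuh2019, §2.4 proof of Lemma 2.21 ("The projection from `J` to
`J♮` should be bijective")] -/
theorem homIndSet_injective : Function.Injective (homIndSet : Set σ → Option σ →₀ ℕ) := fun I J h ↦
  indSet_injective (Finsupp.ext fun i ↦ by rw [← homIndSet_some, ← homIndSet_some, h])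

/-- **Adding an element**: `e^♮_{I + e} = e^♮_I - e_0 + e_e` for `e ∉ I`.
[cite: BrandenHuh2019, §2.4 proof of Lemma 2.21 ("`α - e_i + e_j`")] -/
theorem homIndSet_insert {I : Set σ} {e : σ} (he : e ∉ I) :
    homIndSet (insert e I) = homIndSet I - Finsupp.single none 1 + Finsupp.single (some e) 1 := by
  classical
  ext o
  rw [Finsupp.add_apply, Finsupp.tsub_apply]
  cases o with
  | none =>
    rw [homIndSet_none, homIndSet_none, Set.ncard_insert_of_notMem he (Set.toFinite I), Finsupp.single_eq_same,
      Finsupp.single_eq_of_ne (Option.some_ne_none e).symm]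
    omega
  | some k =>
    rw [homIndSet_some, homIndSet_some, Finsupp.single_eq_of_ne (Option.some_ne_none k), indSet_apply, indSet_apply,
      Finsupp.single_apply]
    simp only [Set.mem_insert_iff, Option.some.injEq]
    by_cases hk : k = e
    · subst hk; simp [he]
    · by_cases hkI : k ∈ I <;> simp [hk, hkI, Ne.symm hk]

/-- **Removing an element**: `e^♮_{I ∖ e} = e^♮_I - e_e + e_0` for `e ∈ I`.
[cite: BrandenHuh2019, §2.4 proof of Lemma 2.21 ("`γ = α - e_i + e_{n+1}`")] -/
theorem homIndSet_diff {I : Set σ} {e : σ} (he : e ∈ I) :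
    homIndSet (I \ {e}) = homIndSet I - Finsupp.single (some e) 1 + Finsupp.single none 1 := by
  classical
  have h1 : 1 ≤ I.ncard := (Nat.one_le_iff_ne_zero).2 fun h0 ↦ by
    rw [Set.ncard_eq_zero (Set.toFinite I)] at h0
    rw [h0] at he
    exact he
  have h2 := ncard_le_card I
  ext o
  rw [Finsupp.add_apply, Finsupp.tsub_apply]
  cases o with
  | none =>
    rw [homIndSet_none, homIndSet_none, Set.ncard_sdiff_singleton_of_mem he, Finsupp.single_eq_same,
      Finsupp.single_eq_of_ne (Option.some_ne_none e).symm]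
    omega
  | some k =>
    rw [homIndSet_some, homIndSet_some, Finsupp.single_eq_of_ne (Option.some_ne_none k), indSet_apply, indSet_apply,
      Finsupp.single_apply]
    simp only [Set.mem_sdiff, Set.mem_singleton_iff, Option.some.injEq]
    by_cases hk : k = e
    · subst hk; simp [he]
    · by_cases hkI : k ∈ I <;> simp [hk, hkI, Ne.symm hk]

/-- **Exchanging an element**: `e^♮_{(I ∖ e) ∪ y} = e^♮_I - e_e + e_y` for `e ∈ I`, `y ∉ I`.
[cite: BrandenHuh2019, §2.4 proof of Lemma 2.21 ("`α - e_i + e_j = γ - e_{n+1} + e_j`")] -/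
theorem homIndSet_insert_diff {I : Set σ} {e y : σ} (he : e ∈ I) (hy : y ∉ I) :
    homIndSet (insert y (I \ {e})) = homIndSet I - Finsupp.single (some e) 1 + Finsupp.single (some y) 1 := by
  have hy' : y ∉ I \ {e} := fun h ↦ hy h.1
  rw [homIndSet_insert hy', homIndSet_diff he, add_tsub_cancel_right]

end HomIndSet

/-! ## §2 The support of `f_M` and its M-convexity (Lemma 2.21, matroid case) -/

section Matroid

/-- **The exponents of `f_M = Σ_{I ∈ 𝓘(M)} w^I w_0^{n-|I|}`**: the finite set `{(n - |I|) e_0 + e_I : I independent in M}`.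
[cite: BrandenHuh2019, §4.3 proof of Thm. 4.14; §2.4 Lemma 2.21] -/
def indepExp (M : Matroid σ) : Finset (Option σ →₀ ℕ) :=
  ((Set.toFinite {I : Set σ | M.Indep I}).image homIndSet).toFinset

/-- `α ∈ indepExp M ⟺ α = (n - |I|) e_0 + e_I` for some independent `I`. [cite: BrandenHuh2019, §4.3 proof of Thm. 4.14] -/
theorem mem_indepExp {M : Matroid σ} {α : Option σ →₀ ℕ} : α ∈ indepExp M ↔ ∃ I, M.Indep I ∧ homIndSet I = α := by
  rw [indepExp, Set.Finite.mem_toFinset, Set.mem_image]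
  rfl

/-- `e^♮_I ∈ indepExp M ⟺ I` is independent. [cite: BrandenHuh2019, §4.3 proof of Thm. 4.14] -/
theorem homIndSet_mem_indepExp {M : Matroid σ} {I : Set σ} : homIndSet I ∈ indepExp M ↔ M.Indep I := by
  rw [mem_indepExp]
  constructor
  · rintro ⟨I', hI', h⟩
    rwa [← homIndSet_injective h]
  · exact fun h ↦ ⟨I, h, rfl⟩

/-- All exponents of `f_M` have degree `n`. [cite: BrandenHuh2019, §4.3 proof of Thm. 4.14] -/
theorem degree_eq_of_mem_indepExp {M : Matroid σ} {α : Option σ →₀ ℕ} (hα : α ∈ indepExp M) :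
    α.degree = Fintype.card σ := by
  obtain ⟨I, -, rfl⟩ := mem_indepExp.1 hα
  exact degree_homIndSet I

/-- Mathlib's augmentation for finite independent sets, with `ncard`: if `|I| < |J|` then some `e ∈ J ∖ I` keeps `I + e`
independent. [cite: BrandenHuh2019, §2.4 (the augmentation property, before Lemma 2.21)] -/
theorem exists_insert_indep_of_ncard_lt {M : Matroid σ} {I J : Set σ} (hI : M.Indep I) (hJ : M.Indep J)
    (hIJ : I.ncard < J.ncard) : ∃ e ∈ J \ I, M.Indep (insert e I) :=
  hI.augment hJ (by
    rw [← (Set.toFinite I).cast_ncard_eq, ← (Set.toFinite J).cast_ncard_eq]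
    exact_mod_cast hIJ)

/-- **Brändén–Huh Lemma 2.21, matroid case ("if" direction): the homogenised independent sets
`{(n - |I|) e_0 + e_I : I ∈ 𝓘(M)}` of a matroid form an M-convex set** — equivalently the independent sets form an
M♮-convex subset of `{0,1}^n`; this is the support of `f_M` (§4.3). The exchange property is checked as printed: for
`i = 0` by augmentation, for `i ∈ I` with `α_0 < β_0` by passing to `I ∖ i`, and otherwise by augmenting `I ∖ i` from `J`.
[cite: BrandenHuh2019, §2.4 Lemma 2.21 (proof of the "if" direction); §4.3 proof of Thm. 4.14] -/
theorem isMConvex_indepExp (M : Matroid σ) : IsMConvex ((indepExp M : Finset (Option σ →₀ ℕ)) : Set (Option σ →₀ ℕ)) := by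
  intro α β hα hβ i hi
  rw [Finset.mem_coe, mem_indepExp] at hα hβ
  obtain ⟨I, hI, rfl⟩ := hα
  obtain ⟨J, hJ, rfl⟩ := hβ
  have hIn := ncard_le_card I
  have hJn := ncard_le_card J
  cases i with
  | none =>
    -- `α_0 > β_0`, i.e. `|I| < |J|`: augment `I` from `J`
    rw [homIndSet_none, homIndSet_none] at hi
    obtain ⟨e, ⟨heJ, heI⟩, hIe⟩ := exists_insert_indep_of_ncard_lt hI hJ (by omega)
    refine ⟨some e, ?_, ?_⟩
    · rw [homIndSet_some, homIndSet_some, (indSet_eq_zero_iff I e).2 heI]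
      exact Nat.pos_of_ne_zero ((indSet_ne_zero_iff J e).2 heJ)
    · rw [← homIndSet_insert heI, Finset.mem_coe, homIndSet_mem_indepExp]
      exact hIe
  | some e =>
    -- `α_e > β_e`, i.e. `e ∈ I ∖ J`
    rw [homIndSet_some, homIndSet_some] at hi
    have heI : e ∈ I := (indSet_ne_zero_iff I e).1 (by omega)
    have heJ : e ∉ J := fun h ↦ by
      have h1 := indSet_le_one I e
      have h2 : indSet J e ≠ 0 := (indSet_ne_zero_iff J e).2 h
      omega
    by_cases hlt : J.ncard < I.ncard
    · -- `α_0 < β_0`: take `j = 0`, landing on `I ∖ e`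
      refine ⟨none, ?_, ?_⟩
      · rw [homIndSet_none, homIndSet_none]; omega
      · rw [← homIndSet_diff heI, Finset.mem_coe, homIndSet_mem_indepExp]
        exact hI.subset Set.sdiff_subset
    · -- `α_0 ≥ β_0`: augment `I ∖ e` (of size `|I| - 1 < |J|`) from `J`
      have hI' : M.Indep (I \ {e}) := hI.subset Set.sdiff_subset
      have hcard : (I \ {e}).ncard < J.ncard := by
        rw [Set.ncard_sdiff_singleton_of_mem heI]
        have h1 : 1 ≤ I.ncard := (Nat.one_le_iff_ne_zero).2 fun h0 ↦ by
          rw [Set.ncard_eq_zero (Set.toFinite I)] at h0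
          rw [h0] at heI
          exact heI
        omega
      obtain ⟨y, ⟨hyJ, hyI'⟩, hIy⟩ := exists_insert_indep_of_ncard_lt hI' hJ hcard
      have hye : y ≠ e := fun h ↦ heJ (h ▸ hyJ)
      have hyI : y ∉ I := fun h ↦ hyI' ⟨h, hye⟩
      refine ⟨some y, ?_, ?_⟩
      · rw [homIndSet_some, homIndSet_some, (indSet_eq_zero_iff I y).2 hyI]
        exact Nat.pos_of_ne_zero ((indSet_ne_zero_iff J y).2 hyJ)
      · rw [← homIndSet_insert_diff heI hyI, Finset.mem_coe, homIndSet_mem_indepExp]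
        exact hIy

end Matroid

end Literature.Combinatorics.LorentzianPolynomials

end
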